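import Summits.BirchSwinnertonDyer.Rank1Residual.F1Sign2.AdditiveNewPartLawsAtTwo
import Literature.NumberTheory.EllipticCurves.Sprung2017.SharpFlatPAdicLFunctionTwoProofs
import Literature.NumberTheory.EllipticCurves.PAdicBSDSplitMultiplicativeProofs
import Literature.NumberTheory.EllipticCurves.CuspFormLFunctionLevelConductorProofs
import Literature.NumberTheory.EllipticCurves.IsogenyFaltingsLFunctionProofs
import Literature.NumberTheory.EllipticCurves.RootNumberTwistProofs
import Literature.NumberTheory.EllipticCurves.BSDRootNumberLocalTablesProofs
import Literature.NumberTheory.EllipticCurves.PAdicLFunctionDistributionHoldsProofs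
import Literature.NumberTheory.EllipticCurves.PAdicLFunctionDistributionProofs
import Literature.NumberTheory.EllipticCurves.PAdicLFunctionIntegralityAtTwoProofs
import HarnessLib

/-!
# Cell `bsd-f1-sign2`: IMC-ADD2-DEFL `AdditiveMazurTateDeflationAtTwo` is a THEOREM —
# `additiveMazurTateDeflationAtTwo_holds` (the deflation of the Mazur–Tate element at additive `2`)

PROOF FILE (seat `-ty` g9, the typer's «discharge when cheap»; statement file `F1Sign2/AdditiveNewPartLawsAtTwo.lean`, p628841,
-imc g7 row IMC-ADD2-DEFL = MEMO-imc §10.64, «support, PROVABLE»; REF1 §95 r4 had recorded the in-tree proof as «modulo the symbol-level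
`U₂`-relation at `4 ∣ N`, which the tree has only for `¬ p ∣ N` and `p ∥ N`» — in fact the tree HAS it for every `p ∣ N`:
`intCast_mul_ratPlusSymbol_of_dvd` (`PAdicBSDSplitMultiplicativeProofs`, MTT §I.4 (4.2) / §I.10), and the level of the newform of `W` is
divisible by `2` iff its conductor is (`IsNewformOf.dvd_level_iff_dvd_conductorNorm`, `q`-expansion arithmetic), so no «level = conductor»
fact is needed).  THEOREMS ONLY (no `def`, no `sorry`, standard axioms); nothing is asserted beyond what is proved.

THE PRINTED ARGUMENT (Doyon–Lei 2021, Lemma 5.2 «See [MT]»; Mazur–Tate–Teitelbaum 1986 §I.4 (4.2), §I.10, §I.13), followed line by line: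
* `ratPlusSymbol_half_add_half_add_one` — the `U₂`-relation `a₂(f)[x]⁺ = [x/2]⁺ + [(x+1)/2]⁺` with `a₂(f) = 0`: `[x/2]⁺ + [(x+1)/2]⁺ = 0`;
  hence `[1/4]⁺ = 0` (`x = 1/2`, periodicity `ratPlusSymbol_add_intCast_eq` and evenness `ratPlusSymbol_neg`) and `[a + 1/2]⁺ = −[a]⁺`
  (`x = 2a`).
* `mazurTateElement_two_zero` — `θ₀(f) = C (2·[1/4]⁺)` (`Sprung2017.mazurTateElement_two_eq`: `Δ = {±1}`, `γ = 5`), so `θ₀ = 0`.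
* `cyclotomicGenerator_pow_add_two_pow` — `5^{t+2^m} ≡ 5^t + 2^{m+2} (mod 2^{m+3})` (from `5^{2^m} = 1 + 2^{m+2} + 2^{m+3}a` by induction,
  `five_pow_two_pow`), whence the FIBRE CANCELLATION `[γ^{t+2^m}/2^{m+3}]⁺ = [γ^t/2^{m+3} + 1/2]⁺ = −[γ^t/2^{m+3}]⁺`
  (`ratPlusSymbol_cyclotomicGenerator_pow_add_two_pow`).
* `omega_dvd_mazurTateElement_two_succ` — pairing `s ↔ s + 2^m` in `ℤ/2^{m+1}` (`Fintype.sum_equiv (Equiv.addRight _)`): each pair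
  contributes `C(2c_t)(X+1)^t(1 − (X+1)^{2^m})`, so `ω_m = (X+1)^{2^m} − 1` divides `2·θ_{m+1}`, hence `θ_{m+1}` (`2` is a unit of `ℚ[X]`).
* `additiveMazurTateDeflationAtTwo_holds` — for `IsNewformOf W f` and `4 ∣ N_W`: rational symbols (`IsNewformOf.coeffField_eq_bot_of_isNewformOf`,
  `ratCast_ratPlusSymbol_holds`), `2 ∣ N` (`dvd_level_iff_dvd_conductorNorm`), `a₂(f) = a₂(W) = 0` (`natGenerator_sq_dvd_conductorNorm_iff`:
  `4 ∣ N_W ⟺` additive at `2`; `LFunction_apply_eq_zero_of_hasAdditiveReductionAt`), then the two items above.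

Consequence for the cell (CANDIDATES row IMC-ADD2-DEFL): the row is PROVED; the junk guard of `newPartNormTwoVal` (REF1 §95 r5) and the «old part
of `θ_n` vanishes identically» step of the IMC-ADD2 / IMC-NP2 docstrings are now kernel facts.  Census agreement: -imc D-imc-22/23 found `θ_0 = 0`
on 4 466/4 466 additive curves and cor-exactness on 22 330/22 330 layer pairs — as it must be.  PARTITION: none (support row); beyond-print theorem:
no (Doyon–Lei 2021 Lemma 5.2 / MTT); BSD is not proved by any of this.
[cite: DoyonLei2021, Lemma 5.2, Cor. 5.3] [cite: MazurTateTeitelbaum1986Invent, §I.4 (4.2), §I.10, §I.13]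
-/

noncomputable section

open scoped Classical MatrixGroups ModularForm NumberField

open CongruenceSubgroup Polynomial WeierstrassCurve Literature.NumberTheory.EllipticCurves
  Literature.NumberTheory.EllipticCurves.ModularForms
  Literature.NumberTheory.EllipticCurves.Rank1Residual IsDedekindDomain IsDedekindDomain.HeightOneSpectrum
  Rat.HeightOneSpectrum NumberField

namespace Summit.BirchSwinnertonDyer.Rank1Residual.F1Sign2

variable {N : ℕ} [NeZero N] (f : CuspForm (Gamma0 N) 2)

/-! ## The `U₂`-relation with `a₂ = 0` and its two consequences for the plus symbol -/

/-- The `U₂`-relation `a₂(f)·[x]⁺ = [x/2]⁺ + [(x+1)/2]⁺` (`intCast_mul_ratPlusSymbol_of_dvd`, any `2 ∣ N`) with `a₂(f) = 0`: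
`[x/2]⁺_f + [(x+1)/2]⁺_f = 0` for every `x ∈ ℚ`. [cite: MazurTateTeitelbaum1986Invent, §I.4 (4.2)] -/
theorem ratPlusSymbol_half_add_half_add_one (hf : IsNewform0 f) (h2N : 2 ∣ N) (ha2 : cuspCoeff f 2 = 0)
    (hrat : ∀ r : ℚ, (ratPlusSymbol f r : ℝ) = normalizedPlusSymbol f r) (x : ℚ) :
    ratPlusSymbol f (x / 2) + ratPlusSymbol f ((x + 1) / 2) = 0 := by
  have h := intCast_mul_ratPlusSymbol_of_dvd 2 hf Nat.prime_two h2N (ap := 0)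
    (by rw [ha2, Int.cast_zero]) hrat x
  rw [Int.cast_zero, zero_mul, Fin.sum_univ_two] at h
  simp only [Fin.val_zero, Fin.val_one, Nat.cast_zero, Nat.cast_one, add_zero, Nat.cast_ofNat] at h
  exact h.symm

/-- Consequence 1: `[1/4]⁺_f = 0` (`x = 1/2`, periodicity and evenness of `[·]⁺`). -/
theorem ratPlusSymbol_one_div_four_eq_zero (hf : IsNewform0 f) (h2N : 2 ∣ N) (ha2 : cuspCoeff f 2 = 0)
    (hrat : ∀ r : ℚ, (ratPlusSymbol f r : ℝ) = normalizedPlusSymbol f r) :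
    ratPlusSymbol f (1 / 4) = 0 := by
  have h := ratPlusSymbol_half_add_half_add_one f hf h2N ha2 hrat (1 / 2)
  have e1 : (1 / 2 : ℚ) / 2 = 1 / 4 := by norm_num
  have e2 : ((1 / 2 : ℚ) + 1) / 2 = -(1 / 4) + ((1 : ℤ) : ℚ) := by norm_num
  rw [e1, e2, ratPlusSymbol_add_intCast_eq, ratPlusSymbol_neg] at h
  linarith

/-- Consequence 2: `[a + 1/2]⁺_f = −[a]⁺_f` (`x = 2a`). -/
theorem ratPlusSymbol_add_half (hf : IsNewform0 f) (h2N : 2 ∣ N) (ha2 : cuspCoeff f 2 = 0)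
    (hrat : ∀ r : ℚ, (ratPlusSymbol f r : ℝ) = normalizedPlusSymbol f r) (a : ℚ) :
    ratPlusSymbol f (a + 1 / 2) = -ratPlusSymbol f a := by
  have h := ratPlusSymbol_half_add_half_add_one f hf h2N ha2 hrat (2 * a)
  have e1 : (2 * a : ℚ) / 2 = a := by ring
  have e2 : ((2 * a : ℚ) + 1) / 2 = a + 1 / 2 := by ring
  rw [e1, e2] at h
  linarith

/-! ## `θ₀ = 2·[1/4]⁺` and the layer-`0` vanishing -/

/-- `θ₀(f) = C (2·[1/4]⁺_f)` at `p = 2` (`Δ = {±1}`, `γ⁰ = 1`, level `2^{0+2} = 4`). -/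
theorem mazurTateElement_two_zero : mazurTateElement f 2 0 = C (2 * ratPlusSymbol f (1 / 4)) := by
  rw [Sprung2017.mazurTateElement_two_eq]
  have hu : (Finset.univ : Finset (ZMod (2 ^ 0))) = {0} := rfl
  rw [hu, Finset.sum_singleton]
  haveI : Fact (1 < 2 ^ (0 + 2)) := ⟨by norm_num⟩
  rw [ZMod.val_zero, pow_zero, pow_zero, mul_one, ZMod.val_one, Nat.cast_one]
  norm_num

/-! ## The fibre cancellation `[γ^{t+2^m}/2^{m+3}]⁺ = −[γ^t/2^{m+3}]⁺` -/

/-- `5^{2^m} = 1 + 2^{m+2} + 2^{m+3}·a`. -/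
theorem five_pow_two_pow (m : ℕ) : ∃ a : ℤ, (5 : ℤ) ^ (2 ^ m) = 1 + 2 ^ (m + 2) + 2 ^ (m + 3) * a := by
  induction m with
  | zero => exact ⟨0, by norm_num⟩
  | succ m ih =>
    obtain ⟨a, ha⟩ := ih
    refine ⟨a + 2 ^ m * (1 + 2 * a) ^ 2, ?_⟩
    rw [pow_succ, pow_mul, ha]
    ring

/-- `5^{t+2^m} = 5^t + 2^{m+2} + 2^{m+3}·b`. -/
theorem five_pow_add_two_pow (m t : ℕ) :
    ∃ b : ℤ, (5 : ℤ) ^ (t + 2 ^ m) = 5 ^ t + 2 ^ (m + 2) + 2 ^ (m + 3) * b := by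
  obtain ⟨a, ha⟩ := five_pow_two_pow m
  have h5 : Odd (5 : ℤ) := ⟨2, by norm_num⟩
  obtain ⟨c, hc⟩ := (h5.pow : Odd ((5 : ℤ) ^ t))
  refine ⟨c + 5 ^ t * a, ?_⟩
  rw [pow_add, ha]
  linear_combination (2 ^ (m + 2) : ℤ) * hc

/-- In `ZMod 2^{m+3}`: `γ^{t+2^m} = γ^t + 2^{m+2}` (`γ = 5`). -/
theorem cyclotomicGenerator_pow_add_two_pow (m t : ℕ) :
    (cyclotomicGenerator 2 : ZMod (2 ^ (m + 1 + 2))) ^ (t + 2 ^ m) =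
      (cyclotomicGenerator 2 : ZMod (2 ^ (m + 1 + 2))) ^ t + ((2 ^ (m + 2) : ℕ) : ZMod (2 ^ (m + 1 + 2))) := by
  obtain ⟨b, hb⟩ := five_pow_add_two_pow m t
  rw [cyclotomicGenerator_two]
  have h := congrArg (Int.cast : ℤ → ZMod (2 ^ (m + 1 + 2))) hb
  push_cast at h
  have hz : ((2 : ZMod (2 ^ (m + 1 + 2))) ^ (m + 3)) = 0 := by
    have : (((2 ^ (m + 1 + 2) : ℕ) : ZMod (2 ^ (m + 1 + 2)))) = 0 := ZMod.natCast_self _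
    rw [show m + 3 = m + 1 + 2 by ring]
    exact_mod_cast this
  rw [hz, zero_mul, add_zero] at h
  push_cast
  exact h

/-- FIBRE CANCELLATION for the layer coefficients `c_m(t) := [γ^t / 2^{m+3}]⁺_f` (`γ^t` reduced mod `2^{m+3}`):
`c_m(t + 2^m) = −c_m(t)` — since `γ^{t+2^m} ≡ γ^t + 2^{m+2} (mod 2^{m+3})`, the two arguments differ by `1/2` modulo `ℤ`. -/
theorem ratPlusSymbol_cyclotomicGenerator_pow_add_two_pow (hf : IsNewform0 f) (h2N : 2 ∣ N)
    (ha2 : cuspCoeff f 2 = 0) (hrat : ∀ r : ℚ, (ratPlusSymbol f r : ℝ) = normalizedPlusSymbol f r) (m t : ℕ) :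
    ratPlusSymbol f ((((cyclotomicGenerator 2 : ZMod (2 ^ (m + 1 + 2))) ^ (t + 2 ^ m)).val : ℚ) /
        (2 : ℚ) ^ (m + 1 + 2)) =
      -ratPlusSymbol f ((((cyclotomicGenerator 2 : ZMod (2 ^ (m + 1 + 2))) ^ t).val : ℚ) /
        (2 : ℚ) ^ (m + 1 + 2)) := by
  set M : ℕ := 2 ^ (m + 1 + 2) with hM
  haveI : NeZero M := ⟨by positivity⟩
  set A : ℕ := ((cyclotomicGenerator 2 : ZMod M) ^ t).val with hA
  have hlt : 2 ^ (m + 2) < M := by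
    rw [hM]; exact Nat.pow_lt_pow_right (by norm_num) (by omega)
  have hB : ((cyclotomicGenerator 2 : ZMod M) ^ (t + 2 ^ m)).val = (A + 2 ^ (m + 2)) % M := by
    rw [cyclotomicGenerator_pow_add_two_pow, ZMod.val_add, ZMod.val_natCast, Nat.mod_eq_of_lt hlt]
  -- `B = A + 2^{m+2} − M·d`
  set d : ℕ := (A + 2 ^ (m + 2)) / M with hd
  have hBd : (((A + 2 ^ (m + 2)) % M : ℕ) : ℚ) = (A : ℚ) + 2 ^ (m + 2) - (M : ℚ) * d := by
    have := Nat.mod_add_div (A + 2 ^ (m + 2)) M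
    have h' : (((A + 2 ^ (m + 2)) % M : ℕ) : ℚ) + (M : ℚ) * d = (A : ℚ) + 2 ^ (m + 2) := by
      exact_mod_cast this
    linarith
  have hMq : (M : ℚ) = 2 * 2 ^ (m + 2) := by
    rw [hM]; push_cast; ring
  rw [hB, hBd]
  have e : ((A : ℚ) + 2 ^ (m + 2) - (M : ℚ) * d) / (2 : ℚ) ^ (m + 1 + 2) =
      ((A : ℚ) / (2 : ℚ) ^ (m + 1 + 2) + 1 / 2) + ((-(d : ℤ) : ℤ) : ℚ) := by
    have h2 : (2 : ℚ) ^ (m + 1 + 2) = (M : ℚ) := by rw [hM]; push_cast; ring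
    rw [h2, hMq]
    push_cast
    field_simp
    ring
  rw [e, ratPlusSymbol_add_intCast_eq, ratPlusSymbol_add_half f hf h2N ha2 hrat]

/-! ## `ω_m ∣ θ_{m+1}` -/

/-- **`(X+1)^{2^m} − 1 ∣ θ_{m+1}(f)`** for `2 ∣ N`, `a₂(f) = 0` and rational symbols. -/
theorem omega_dvd_mazurTateElement_two_succ (hf : IsNewform0 f) (h2N : 2 ∣ N) (ha2 : cuspCoeff f 2 = 0)
    (hrat : ∀ r : ℚ, (ratPlusSymbol f r : ℝ) = normalizedPlusSymbol f r) (m : ℕ) :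
    ((X + 1) ^ (2 ^ m) - 1 : ℚ[X]) ∣ mazurTateElement f 2 (m + 1) := by
  rw [Sprung2017.mazurTateElement_two_eq]
  -- the layer coefficients `c(t) = [γ^t/2^{m+3}]⁺`
  set c : ℕ → ℚ := fun t ↦ ratPlusSymbol f
    ((((cyclotomicGenerator 2 : ZMod (2 ^ (m + 1 + 2))) ^ t).val : ℚ) / (2 : ℚ) ^ (m + 1 + 2)) with hc_def
  have hF : ∀ s : ZMod (2 ^ (m + 1)),
      C (2 * ratPlusSymbol f ((((cyclotomicGenerator 2 : ZMod (2 ^ (m + 1 + 2))) ^ s.val).val : ℚ) /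
        (2 : ℚ) ^ (m + 1 + 2))) * (X + 1) ^ s.val = C (2 * c s.val) * (X + 1) ^ s.val := by
    intro s; rfl
  simp only [hF]
  set D : ℚ[X] := (X + 1) ^ (2 ^ m) - 1 with hD
  haveI : NeZero (2 ^ (m + 1)) := ⟨by positivity⟩
  set T : ZMod (2 ^ (m + 1)) := ((2 ^ m : ℕ) : ZMod (2 ^ (m + 1))) with hT
  have h2m : 2 ^ (m + 1) = 2 ^ m + 2 ^ m := by ring
  have hpos : 0 < 2 ^ m := by positivity
  have hTval : T.val = 2 ^ m := by
    rw [hT, ZMod.val_natCast, Nat.mod_eq_of_lt (by omega)]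
  have hval : ∀ s : ZMod (2 ^ (m + 1)),
      (s + T).val = if s.val < 2 ^ m then s.val + 2 ^ m else s.val - 2 ^ m := by
    intro s
    have hs := ZMod.val_lt s
    rw [ZMod.val_add, hTval]
    split_ifs with h
    · exact Nat.mod_eq_of_lt (by omega)
    · rw [Nat.mod_eq_sub_mod (by omega), Nat.mod_eq_of_lt (by omega)]
      omega
  have hc : ∀ t : ℕ, c (t + 2 ^ m) = -c t := fun t ↦
    ratPlusSymbol_cyclotomicGenerator_pow_add_two_pow f hf h2N ha2 hrat m t
  have hpair : ∀ s : ZMod (2 ^ (m + 1)),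
      D ∣ C (2 * c s.val) * (X + 1) ^ s.val +
        C (2 * c (s + T).val) * (X + 1) ^ (s + T).val := by
    intro s
    by_cases h : s.val < 2 ^ m
    · have hv : (s + T).val = s.val + 2 ^ m := by rw [hval, if_pos h]
      refine ⟨-(C (2 * c s.val) * (X + 1) ^ s.val), ?_⟩
      rw [hv, hc, mul_neg, C_neg, pow_add (X + 1 : ℚ[X]) s.val (2 ^ m), hD]
      ring
    · set t' : ℕ := s.val - 2 ^ m with ht'
      have ht : s.val = t' + 2 ^ m := by omega
      have hv : (s + T).val = t' := by rw [hval, if_neg h]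
      refine ⟨-(C (2 * c t') * (X + 1) ^ t'), ?_⟩
      rw [hv, ht, hc, mul_neg, C_neg, pow_add (X + 1 : ℚ[X]) t' (2 ^ m), hD]
      ring
  have hsum : ∑ s : ZMod (2 ^ (m + 1)), C (2 * c (s + T).val) * (X + 1) ^ (s + T).val =
      ∑ s : ZMod (2 ^ (m + 1)), C (2 * c s.val) * (X + 1) ^ s.val :=
    Fintype.sum_equiv (Equiv.addRight T) _ _ (fun _ ↦ rfl)
  have hdvd : D ∣ ∑ s : ZMod (2 ^ (m + 1)), (C (2 * c s.val) * (X + 1) ^ s.val +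
      C (2 * c (s + T).val) * (X + 1) ^ (s + T).val) :=
    Finset.dvd_sum fun s _ ↦ hpair s
  rw [Finset.sum_add_distrib, hsum, ← two_mul] at hdvd
  have hu : IsUnit (2 : ℚ[X]) := by
    rw [← map_ofNat C 2]
    exact isUnit_C.mpr (isUnit_iff_ne_zero.mpr two_ne_zero)
  exact hu.dvd_mul_left.mp hdvd

/-! ## The discharge -/

/-- **IMC-ADD2-DEFL holds**: `AdditiveMazurTateDeflationAtTwo` is a theorem of the tree. -/
theorem additiveMazurTateDeflationAtTwo_holds : AdditiveMazurTateDeflationAtTwo := by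
  intro N _ f W _ hf h4
  -- rational symbols
  have hQ : coeffField f = ⊥ := hf.coeffField_eq_bot_of_isNewformOf
  have hrat : ∀ r : ℚ, (ratPlusSymbol f r : ℝ) = normalizedPlusSymbol f r :=
    fun r ↦ ratCast_ratPlusSymbol_holds hf.1 hQ r
  -- `2 ∣ N`
  have h2NW : (2 : ℕ) ∣ W.conductorNorm ℤ := dvd_trans ⟨2, by norm_num⟩ h4
  have h2N : 2 ∣ N := (hf.dvd_level_iff_dvd_conductorNorm Nat.prime_two).mpr h2NW
  -- `a₂(f) = a₂(W) = 0` (additive reduction at `2`)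
  set v₀ : HeightOneSpectrum ℤ := (primesEquiv (R := ℤ)).symm ⟨2, Nat.prime_two⟩ with hv₀
  have hgen₀ : natGenerator v₀ = 2 :=
    congrArg Subtype.val ((primesEquiv (R := ℤ)).apply_symm_apply ⟨2, Nat.prime_two⟩)
  have hadd₀ : W.HasAdditiveReductionAt v₀ := by
    rw [← natGenerator_sq_dvd_conductorNorm_iff v₀ W, hgen₀]
    simpa using h4
  have hadd : W.HasAdditiveReductionAt ((primesEquiv (R := 𝓞 ℚ)).symm ⟨2, Nat.prime_two⟩) :=
    (W.hasAdditiveReductionAt_int_iff_ringOfIntegers ⟨2, Nat.prime_two⟩).mp hadd₀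
  haveI : Fact (Nat.Prime 2) := ⟨Nat.prime_two⟩
  have hL2 : W.LFunction 2 = 0 :=
    W.LFunction_apply_eq_zero_of_hasAdditiveReductionAt (p := 2)
      (v := (primesEquiv (R := 𝓞 ℚ)).symm ⟨2, Nat.prime_two⟩) (by rw [Equiv.apply_symm_apply]) hadd
      (dvd_refl 2)
  have ha2 : cuspCoeff f 2 = 0 := by rw [hf.2 2, hL2, Int.cast_zero]
  refine ⟨?_, fun n hn ↦ ?_⟩
  · rw [mazurTateElement_two_zero, ratPlusSymbol_one_div_four_eq_zero f hf.1 h2N ha2 hrat, mul_zero, C_0]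
  · obtain ⟨m, rfl⟩ := Nat.exists_eq_add_of_le' hn
    rw [Nat.add_sub_cancel]
    exact omega_dvd_mazurTateElement_two_succ f hf.1 h2N ha2 hrat m

end Summit.BirchSwinnertonDyer.Rank1Residual.F1Sign2

end
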